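import Summits.RiemannHypothesis.RiemannHypothesis.Theorems.HandoffCross
import HarnessLib

/-!
# HANDOFF, edge block: the archimedean cross term and the assembly of the CROSS-TERM bound (rh-explicit, track «HANDOFF», seat prove-2, ATTEMPT-4 §2 (d), §3)

HONEST FRAMING. Nothing here bears on RH. Continuation of `HandoffCross.lean`: (d) the archimedean cross term of two edge
lobes costs `2(b − c′)·M(c′)·(‖f‖₂² + ‖g‖₂²)`, `M(c′) = 1/(e^{c′}(1 − e^{−4c′}))` (Bombieri's form of the archimedean term,
`weilArchTermBombieri_eq_weilArchTerm_holds`: the cross kernel vanishes at `0` and lives on lags `[2c′, 2b]`); then the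
explicit constant `handoffCrossConst` and the PROVED `handoffCrossBound_holds : HandoffCrossBound q q′ η (handoffCrossConst q η)`,
whence `edgeNonneg_of_gapIneq`: the edge block `EdgeNonneg q q′ η` of the Schur route follows from the single explicit
inequality `handoffCrossConst q η b ≤ log(1/(b − c′)) − log⁺log(1/(b − c′)) − 8` on the window — the typed form of ATTEMPT-4's
prime-gap inequality (GAP-q).
-/

set_option linter.dupNamespace false

noncomputable section

open Complex Filter Set MeasureTheory Literature.NumberTheory.LFunctions
open scoped Real Topology ComplexConjugate ContDiff

namespace Summit.RiemannHypothesis.RiemannHypothesis.Theorems.Handoff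

variable {f g : ℝ → ℂ}

/-! ## §6 The archimedean cross term -/

/-- The archimedean kernel bound on the lag range: for `t ≥ 2c′ > 0`, `e^{t/2}/(2 sinh t) ≤ M(c′) := 1/(e^{c′}(1 − e^{−4c′}))`.
[folklore] -/
def archGapBound (c' : ℝ) : ℝ := 1 / (Real.exp c' * (1 - Real.exp (-(4 * c'))))

/-- `M(c′) > 0` for `c′ > 0`. [folklore] -/
theorem archGapBound_pos {c' : ℝ} (hc' : 0 < c') : 0 < archGapBound c' := by
  unfold archGapBound
  have h1 : Real.exp (-(4 * c')) < 1 := Real.exp_lt_one_iff.2 (by linarith)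
  positivity

/-- The pointwise kernel bound: `e^{t/2}/(2 sinh t) ≤ M(c′)` for `t ≥ 2c′ > 0`. [folklore] -/
theorem exp_half_div_two_sinh_le {c' t : ℝ} (hc' : 0 < c') (ht : 2 * c' ≤ t) :
    Real.exp (t / 2) / (2 * Real.sinh t) ≤ archGapBound c' := by
  have ht0 : 0 < t := by linarith
  have hE : 0 < Real.exp (t / 2) := Real.exp_pos _
  have hkey : 2 * Real.sinh t = Real.exp (t / 2) * (Real.exp (t / 2) * (1 - Real.exp (-(2 * t)))) := by
    rw [Real.sinh_eq]
    have e1 : Real.exp t = Real.exp (t / 2) * Real.exp (t / 2) := by rw [← Real.exp_add]; ring_nf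
    have e2 : Real.exp (-t) = Real.exp (t / 2) * Real.exp (t / 2) * Real.exp (-(2 * t)) := by
      rw [← Real.exp_add, ← Real.exp_add]; ring_nf
    rw [e1, e2]; ring
  have hq : 0 < 1 - Real.exp (-(2 * t)) := by
    have : Real.exp (-(2 * t)) < 1 := Real.exp_lt_one_iff.2 (by linarith)
    linarith
  have hq' : 0 < 1 - Real.exp (-(4 * c')) := by
    have : Real.exp (-(4 * c')) < 1 := Real.exp_lt_one_iff.2 (by linarith)
    linarith
  rw [hkey, div_mul_cancel_left₀ hE.ne', archGapBound, one_div]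
  refine inv_anti₀ (mul_pos (Real.exp_pos _) hq') ?_
  refine mul_le_mul (Real.exp_le_exp.2 (by linarith)) ?_ hq'.le hE.le
  have : Real.exp (-(2 * t)) ≤ Real.exp (-(4 * c')) := Real.exp_le_exp.2 (by linarith)
  linarith

/-- **Archimedean cross bound.** For lobes `f ⊆ [c′, b]`, `g ⊆ [−b, −c′]` (`0 < c′ ≤ b`):
`‖W_∞(f ⋆ g̃)‖ ≤ 2(b − c′)·M(c′)·(‖f‖₂² + ‖g‖₂²)` (Bombieri's form of the archimedean term: the kernel vanishes at `0`,
the integrand lives on `t ∈ [2c′, 2b]` where `e^{t/2}/(2 sinh t) ≤ M(c′)`). [cite: Bombieri2000, Thm 2 (archimedean term, x = e^t)] -/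
theorem norm_weilArchTerm_cross_le (hf : IsWeilTest f) (hg : IsWeilTest g) {c' b : ℝ} (hc' : 0 < c') (hcb : c' ≤ b)
    (hfs : tsupport f ⊆ Icc c' b) (hgs : tsupport g ⊆ Icc (-b) (-c')) :
    ‖weilArchTerm (weilConv f (weilReflect g))‖ ≤
      2 * (b - c') * archGapBound c' * ((∫ u : ℝ, ‖f u‖ ^ 2) + ∫ u : ℝ, ‖g u‖ ^ 2) := by
  set k := weilConv f (weilReflect g) with hk_def
  have hk : IsWeilTest k := hf.weilConv hg.weilReflect
  set N := ((∫ u : ℝ, ‖f u‖ ^ 2) + ∫ u : ℝ, ‖g u‖ ^ 2) / 2 with hN_def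
  have hNb : ∀ y, ‖k y‖ ≤ N := fun y ↦ norm_weilConv_weilReflect_le_half_add hf hg y
  have hlt : ∀ y, y < 2 * c' → k y = 0 := fun y hy ↦
    weilConv_weilReflect_eq_zero_of_lt hfs hgs (by linarith)
  have hgt : ∀ y, 2 * b < y → k y = 0 := fun y hy ↦
    weilConv_weilReflect_eq_zero_of_gt hfs hgs (by linarith)
  have hk0 : k 0 = 0 := hlt 0 (by linarith)
  rw [← weilArchTermBombieri_eq_weilArchTerm_holds hk]
  unfold weilArchTermBombieri
  rw [hk0]
  simp only [mul_zero, sub_zero, zero_add, norm_neg]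
  -- restrict to [2c', 2b]
  have hsub : Icc (2 * c') (2 * b) ⊆ Ioi (0 : ℝ) := fun x hx ↦ lt_of_lt_of_le (by linarith) hx.1
  rw [setIntegral_eq_of_subset_of_forall_sdiff_eq_zero measurableSet_Ioi hsub (fun t ht ↦ by
    have ht0 : 0 < t := ht.1
    have : k t = 0 ∧ k (-t) = 0 := by
      refine ⟨?_, hlt (-t) (by linarith)⟩
      rcases lt_or_ge t (2 * c') with h1 | h1
      · exact hlt t h1
      · have h2 : 2 * b < t := by
          by_contra h2
          exact ht.2 ⟨h1, not_lt.1 h2⟩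
        exact hgt t h2
    rw [this.1, this.2]; simp)]
  have hvol : volume.real (Icc (2 * c') (2 * b)) = 2 * b - 2 * c' := Real.volume_real_Icc_of_le (by linarith)
  have hbd : ∀ t ∈ Icc (2 * c') (2 * b),
      ‖(Real.exp (t / 2) : ℂ) * (k t + k (-t)) / (2 * Real.sinh t : ℂ)‖ ≤ archGapBound c' * (2 * N) := by
    intro t ht
    have ht0 : 0 < t := lt_of_lt_of_le (by linarith) ht.1
    have hsh : 0 < Real.sinh t := Real.sinh_pos_iff.2 ht0
    rw [norm_div, norm_mul, Complex.norm_real, Real.norm_eq_abs, abs_of_pos (Real.exp_pos _),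
      show ((2 : ℂ) * (Real.sinh t : ℂ)) = ((2 * Real.sinh t : ℝ) : ℂ) by push_cast; ring, Complex.norm_real,
      Real.norm_eq_abs, abs_of_pos (by positivity)]
    rw [mul_div_right_comm]
    refine mul_le_mul (exp_half_div_two_sinh_le hc' ht.1) ?_ (norm_nonneg _) (archGapBound_pos hc').le
    exact (norm_add_le _ _).trans (by linarith [hNb t, hNb (-t)])
  calc ‖∫ t in Icc (2 * c') (2 * b), ((Real.exp (t / 2) : ℂ) * (k t + k (-t))) / (2 * Real.sinh t : ℂ)‖
      ≤ archGapBound c' * (2 * N) * volume.real (Icc (2 * c') (2 * b)) :=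
        norm_setIntegral_le_of_norm_le_const (by rw [Real.volume_Icc]; exact ENNReal.ofReal_lt_top) hbd
    _ = 2 * (b - c') * archGapBound c' * ((∫ u : ℝ, ‖f u‖ ^ 2) + ∫ u : ℝ, ‖g u‖ ^ 2) := by
        rw [hvol, hN_def]; ring

/-! ## §7 Assembly: the cross-term bound and the edge block -/

/-- The explicit cross-term constant of ATTEMPT-4: `X(b) = (e^b + e^{−c′} + 4M(c′))(b − c′) + 2·gapAtomSum(c′, b)`,
`c′ = (log q)/2 − η`. [this track, ATTEMPT-4 §2] -/
def handoffCrossConst (q : ℕ) (η b : ℝ) : ℝ :=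
  (Real.exp b + Real.exp (-(Real.log q / 2 - η)) + 4 * archGapBound (Real.log q / 2 - η)) *
      (b - (Real.log q / 2 - η)) +
    2 * gapAtomSum (Real.log q / 2 - η) b

/-- **The cross-term bound holds with the explicit constant** (`0 < η < (log q)/2`). [this track, ATTEMPT-4 §2 (b)–(d)] -/
theorem handoffCrossBound_holds {q q' : ℕ} {η : ℝ} (hη : 0 ≤ η) (hη' : η < Real.log q / 2) :
    HandoffCrossBound q q' η (handoffCrossConst q η) := by
  intro b hb f g hf hg hfs hgs
  set c' := Real.log q / 2 - η with hc'
  have hc'0 : 0 < c' := by rw [hc']; linarith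
  have hcb : c' ≤ b := by rw [hc']; linarith [hb.1, hη]
  set Nf := ∫ u : ℝ, ‖f u‖ ^ 2
  set Ng := ∫ u : ℝ, ‖g u‖ ^ 2
  have hNf : 0 ≤ Nf := integral_nonneg fun _ ↦ by positivity
  have hNg : 0 ≤ Ng := integral_nonneg fun _ ↦ by positivity
  -- kernels
  have hk1 : IsWeilTest (weilConv f (weilReflect g)) := hf.weilConv hg.weilReflect
  have hk2 : IsWeilTest (weilConv g (weilReflect f)) := hg.weilConv hf.weilReflect
  -- polar
  have hP := norm_weilPolarTerm_cross_le hf hg hfs hgs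
  have hAB := integral_norm_mul_integral_norm_le hf hg hcb (by linarith : -b ≤ -c') (le_refl (b - c'))
    (by linarith : -c' - -b ≤ b - c') hfs hgs
  -- primes
  have hPr1 : ‖weilPrimeTerm (weilConv f (weilReflect g))‖ ≤ 2 * gapAtomSum c' b * ((Nf + Ng) / 2) :=
    norm_weilPrimeTerm_le_of_support hc'0
      (fun y hy ↦ weilConv_weilReflect_eq_zero_of_lt hfs hgs (by linarith [(abs_lt.1 hy).2]))
      (fun y hy ↦ by
        rcases lt_or_ge y 0 with h0 | h0
        · exact weilConv_weilReflect_eq_zero_of_lt hfs hgs (by rw [abs_of_neg h0] at hy; linarith)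
        · exact weilConv_weilReflect_eq_zero_of_gt hfs hgs (by rw [abs_of_nonneg h0] at hy; linarith))
      (norm_weilConv_weilReflect_le_half_add hf hg)
  have hPr2 : ‖weilPrimeTerm (weilConv g (weilReflect f))‖ ≤ 2 * gapAtomSum c' b * ((Ng + Nf) / 2) :=
    norm_weilPrimeTerm_le_of_support hc'0
      (fun y hy ↦ weilConv_weilReflect_eq_zero_of_gt hgs hfs (by linarith [(abs_lt.1 hy).1]))
      (fun y hy ↦ by
        rcases lt_or_ge y 0 with h0 | h0
        · exact weilConv_weilReflect_eq_zero_of_lt hgs hfs (by rw [abs_of_neg h0] at hy; linarith)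
        · exact weilConv_weilReflect_eq_zero_of_gt hgs hfs (by rw [abs_of_nonneg h0] at hy; linarith))
      (norm_weilConv_weilReflect_le_half_add hg hf)
  -- arch
  have hA1 := norm_weilArchTerm_cross_le hf hg hc'0 hcb hfs hgs
  have hgs' : tsupport g ⊆ Icc (-b) (-c') := hgs
  have hA2 : ‖weilArchTerm (weilConv g (weilReflect f))‖ ≤ 2 * (b - c') * archGapBound c' * (Ng + Nf) := by
    -- reflect: apply the lemma to the pair (g(-·), f(-·))? Simpler: symmetric roles via x ↦ -x is not needed —
    -- use the same lemma with f,g swapped after reflecting supports through `b ↦ b`: the lemma is stated for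
    -- `f ⊆ [c', b]`, `g ⊆ [-b, -c']`; for the swapped kernel use the reflected functions.
    have hfr : IsWeilTest (fun x ↦ f (-x)) := hf.comp_neg
    have hgr : IsWeilTest (fun x ↦ g (-x)) := hg.comp_neg
    have hgrs : tsupport (fun x ↦ g (-x)) ⊆ Icc c' b := by
      intro x hx
      have := tsupport_comp_subset_preimage_of_continuous g continuous_neg (by simpa [Function.comp_def] using hx)
      have hm := hgs this
      simp only [Set.mem_Icc] at hm
      exact ⟨by linarith [hm.2], by linarith [hm.1]⟩
    have hfrs : tsupport (fun x ↦ f (-x)) ⊆ Icc (-b) (-c') := by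
      intro x hx
      have := tsupport_comp_subset_preimage_of_continuous f continuous_neg (by simpa [Function.comp_def] using hx)
      have hm := hfs this
      simp only [Set.mem_Icc] at hm
      exact ⟨by linarith [hm.2], by linarith [hm.1]⟩
    have key : weilConv g (weilReflect f) = fun y ↦ weilConv (fun x ↦ g (-x)) (weilReflect fun x ↦ f (-x)) (-y) := by
      funext y
      rw [weilConv_weilReflect_eq_integral, weilConv_weilReflect_eq_integral]
      have h := integral_neg_eq_self (fun u : ℝ ↦ g (-u) * conj (f (-(u - -y)))) volume
      rw [← h]
      congr 1 with u
      simp only [neg_neg]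
      ring_nf
    have hA := norm_weilArchTerm_cross_le hgr hfr hc'0 hcb hgrs hfrs
    -- arch term is invariant under k ↦ k(-·)
    have harch : weilArchTerm (weilConv g (weilReflect f)) =
        weilArchTerm (weilConv (fun x ↦ g (-x)) (weilReflect fun x ↦ f (-x))) := by
      have hkr : IsWeilTest (weilConv (fun x ↦ g (-x)) (weilReflect fun x ↦ f (-x))) := hgr.weilConv hfr.weilReflect
      rw [← weilArchTermBombieri_eq_weilArchTerm_holds hk2, ← weilArchTermBombieri_eq_weilArchTerm_holds hkr]
      unfold weilArchTermBombieri
      rw [key]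
      simp only [neg_neg, neg_zero]
      congr 1
      congr 1
      refine setIntegral_congr_fun measurableSet_Ioi fun t _ ↦ ?_
      ring
    rw [harch]
    have e : (∫ u : ℝ, ‖g (-u)‖ ^ 2) + ∫ u : ℝ, ‖f (-u)‖ ^ 2 = Ng + Nf := by
      rw [integral_neg_eq_self (fun u : ℝ ↦ ‖g u‖ ^ 2), integral_neg_eq_self (fun u : ℝ ↦ ‖f u‖ ^ 2)]
    rw [e] at hA
    exact hA
  -- assemble
  have hX : handoffCrossConst q η b =
      (Real.exp b + Real.exp (-c') + 4 * archGapBound c') * (b - c') + 2 * gapAtomSum c' b := by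
    rw [handoffCrossConst, hc']
  rw [hX]
  have hre : |(weilFunctional (weilConv f (weilReflect g)) + weilFunctional (weilConv g (weilReflect f))).re| ≤
      ‖weilFunctional (weilConv f (weilReflect g)) + weilFunctional (weilConv g (weilReflect f))‖ :=
    Complex.abs_re_le_norm _
  refine hre.trans ?_
  unfold weilFunctional
  have hM0 : 0 ≤ archGapBound c' := (archGapBound_pos hc'0).le
  have hG0 : 0 ≤ gapAtomSum c' b := gapAtomSum_nonneg c' b
  calc ‖weilPolarTerm (weilConv f (weilReflect g)) - weilPrimeTerm (weilConv f (weilReflect g)) +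
          weilArchTerm (weilConv f (weilReflect g)) +
        (weilPolarTerm (weilConv g (weilReflect f)) - weilPrimeTerm (weilConv g (weilReflect f)) +
          weilArchTerm (weilConv g (weilReflect f)))‖
      = ‖(weilPolarTerm (weilConv f (weilReflect g)) + weilPolarTerm (weilConv g (weilReflect f))) +
          (-weilPrimeTerm (weilConv f (weilReflect g))) + (-weilPrimeTerm (weilConv g (weilReflect f))) +
          weilArchTerm (weilConv f (weilReflect g)) + weilArchTerm (weilConv g (weilReflect f))‖ := by ring_nf
    _ ≤ ‖weilPolarTerm (weilConv f (weilReflect g)) + weilPolarTerm (weilConv g (weilReflect f))‖ +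
          ‖-weilPrimeTerm (weilConv f (weilReflect g))‖ + ‖-weilPrimeTerm (weilConv g (weilReflect f))‖ +
          ‖weilArchTerm (weilConv f (weilReflect g))‖ + ‖weilArchTerm (weilConv g (weilReflect f))‖ := by
        refine (norm_add_le _ _).trans (add_le_add ((norm_add_le _ _).trans (add_le_add
          ((norm_add_le _ _).trans (add_le_add ((norm_add_le _ _).trans (add_le_add le_rfl le_rfl)) le_rfl))
          le_rfl)) le_rfl)
    _ ≤ (Real.exp b + Real.exp (-c') + 4 * archGapBound c') * (b - c') * (Nf + Ng) +
          2 * gapAtomSum c' b * (Nf + Ng) := by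
        rw [norm_neg, norm_neg]
        have hP' : ‖weilPolarTerm (weilConv f (weilReflect g)) + weilPolarTerm (weilConv g (weilReflect f))‖ ≤
            (Real.exp b + Real.exp (-c')) * (b - c') * (Nf + Ng) := by
          refine hP.trans ?_
          have h2 : 0 ≤ 2 * (Real.exp b + Real.exp (-c')) := by positivity
          calc 2 * (Real.exp b + Real.exp (-c')) * ((∫ u : ℝ, ‖f u‖) * ∫ u : ℝ, ‖g u‖)
              ≤ 2 * (Real.exp b + Real.exp (-c')) * ((b - c') / 2 * (Nf + Ng)) := mul_le_mul_of_nonneg_left hAB h2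
            _ = (Real.exp b + Real.exp (-c')) * (b - c') * (Nf + Ng) := by ring
        nlinarith [hP', hPr1, hPr2, hA1, hA2, hM0, hG0, hNf, hNg]
    _ = ((Real.exp b + Real.exp (-c') + 4 * archGapBound c') * (b - c') + 2 * gapAtomSum c' b) * (Nf + Ng) := by ring

/-- **The edge block from the prime-gap inequality** (ATTEMPT-4's (GAP-q), typed): for consecutive primes `q < q′` and an
overlap `0 < η < min((log q)/2, (log 2)/2)`, if the explicit cross constant is dominated by the lobe coercivity,
`X(b) ≤ log(1/(b − c′)) − log⁺log(1/(b − c′)) − 8` for every `b` in the window, then `EdgeNonneg q q′ η`.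
[this track, ATTEMPT-4 §2–§3] -/
theorem edgeNonneg_of_gapIneq {q q' : ℕ} (hcons : ConsecutivePrimes q q') {η : ℝ} (hη : 0 < η)
    (hη' : η < Real.log q / 2) (hη2 : η < Real.log 2 / 2)
    (hgap : ∀ b ∈ Icc (Real.log q / 2) (Real.log q' / 2),
      handoffCrossConst q η b ≤ Real.log (1 / (b - (Real.log q / 2 - η))) -
        Real.posLog (Real.log (1 / (b - (Real.log q / 2 - η)))) - 8) :
    EdgeNonneg q q' η :=
  edgeNonneg_of_crossBound hcons hη hη' hη2 (handoffCrossBound_holds hη.le hη') hgap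

end Summit.RiemannHypothesis.RiemannHypothesis.Theorems.Handoff
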